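import Literature.Topology.FourManifolds.AttachmentBoundarySurgery
import Literature.Topology.FourManifolds.KirbyMoves
import HarnessLib

/-!
# The boundary of `D⁴ ∪_L (2-handles)` is the surgery on the framed link `L` (Kirby I, Lemma 2.1, for links)

Topic `Literature/Topology/FourManifolds`; the `n`-component form of `AttachmentBoundarySurgery.lean`
(there: ONE `2`-handle, `HandleAttachingMap.isOpenGluing_boundary` / `isIntegralSurgery_boundary`),
between the tree's two relational languages: Kosinski's SIMULTANEOUS handle attachments
(`HandleAttachingMap.IsMultiAttachment`; Kosinski 1993, VI §6: `P` is glued from `D⁴ ∖ ⋃ᵢ h̄ᵢ(S)`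
and one copy of `D⁴ ∖ S` per handle along `x ∼ h̄ᵢ α x`) and integral Dehn surgery on a framed LINK
(`IsIntegralSurgeryLink` / `FramedLink.IsSurgery`, `Link.surgeryRel`; `DehnSurgery.lean`,
`KirbyMoves.lean`: `Y` is glued from `S³ ∖ L` and one open solid torus `D̊² × S¹` per component along
`νᵢ (u, t v) ∼ (t u, v)`).

**Theorem** (`FramedLink.isSurgery_boundary_of_isMultiAttachment`; Kirby 1989, Ch. I Lemma 2.1 and
§5 "`N³ = ∂M_L`"; Gompf–Stipsicz 1999, Prop. 5.1.2 / §5.3).  Let `L ⊂ S³ = ∂D⁴` be a framed link with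
finitely many components, `νᵢ` pairwise disjoint oriented tubular neighbourhoods of its components
realising the framings `L.framing i`, and `h̄ᵢ : T → D⁴` attaching maps of `2`-handles whose values
on the unit disc bundle of `T ∩ ∂D⁴` are the `νᵢ` (`h̄ᵢ y = incl (νᵢ (angle y, fibre y))` for `y` of
depth `0` — the clause `carvedEmbed_handle` of `DottedCircleDiagram.Realization`).  If `P` is `D⁴`
with the handles attached along the `h̄ᵢ` (`IsMultiAttachment h̄ (𝓡∂ 4) P`), then for EVERY boundary
datum `bP` of `P`, `bP.carrier` is the surgery on `L`: `L.IsSurgery (𝓡 3) bP.carrier`, presented with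
the very tubes `νᵢ`.  Proof: §1 the link complement `S³ ∖ L` parametrises the boundary of
`D⁴ ∖ ⋃ᵢ h̄ᵢ(S)` by `x ↦ incl x` (smooth, injective, onto and open onto the boundary, with a left
inverse smooth on the boundary — §1 of `AttachmentBoundaryPieces.lean` with the knot complement
replaced by the link complement; stated for any map `φ` with `(φ x : D⁴) = incl x`, so that no
definition is introduced); §2 on the boundary sphere Kosinski's relation of the `i`-th handle IS the
`i`-th surgery relation (the one-handle lemma `glueRel_incl_beltBoundaryPt_iff` at the component
`Lᵢ`); §3 restrict the open embeddings of `P` to the boundary (`OpenEmbeddingBoundaryRestrict.lean`),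
the solid-torus side `beltBoundaryPt` (§2 of `AttachmentBoundaryPieces.lean`) being reused verbatim,
and read the pairwise disjointness of the new solid tori off that of the handle pieces.
Everything here is proved; no definitions and no named facts are introduced.

## References

* R. C. Kirby, *The Topology of 4-Manifolds*, LNM 1374 (1989), Ch. I §2, Lemma 2.1; §5. [Kirby1989]
* R. E. Gompf, A. I. Stipsicz, *4-Manifolds and Kirby Calculus* (1999), §5.3. [GompfStipsicz1999]
* A. A. Kosinski, *Differential Manifolds*, Academic Press (1993), VI §6, (6.1). [Kosinski1993]
* D. Rolfsen, *Knots and Links* (1976), §9.F. [Rolfsen1976]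
-/

open scoped Manifold ContDiff Topology
open Set Function Metric Filter Real

noncomputable section

namespace Literature.Topology.FourManifolds

universe u v

namespace Link

variable {ι : Type v} [Finite ι] {L : Link ι}
  (g : ι → HandleAttachingMap 3 2 (Metric.closedBall (0 : EuclideanSpace ℝ (Fin 4)) 1))
  (ν : ∀ i, Knot.TubularNbhd ⇑(L.component i))
  (hbd : ∀ (i : ι) (y : ↥(handleTube 3 2)), tubeDepth y = 0 →
    (g i).toFun y = (closedBallBoundaryData 3).incl (ν i (tubeAngle y, tubeFibre y)))

/-! ### §1 The link complement parametrises `∂(D⁴ ∖ ⋃ᵢ h̄ᵢ(S))` -/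

include hbd in
/-- **`incl x ∈ D⁴ ∖ ⋃ᵢ h̄ᵢ(S)` iff `x ∈ S³ ∖ L`**: the cores `h̄ᵢ(S)` are the components
`incl (Lᵢ(S¹))` (`HandleAttachingMap.mem_core_iff_of_boundaryValues`). [cite: Kosinski1993, VI §6] -/
theorem incl_mem_coresComplement_iff (x : Metric.sphere (0 : EuclideanSpace ℝ (Fin 4)) 1) :
    (closedBallBoundaryData 3).incl x ∈ HandleAttachingMap.coresComplement g ↔ x ∈ L.complement := by
  rw [HandleAttachingMap.mem_coresComplement, Link.mem_complement_iff]
  constructor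
  · rintro h i ⟨θ, rfl⟩
    exact h i (((g i).mem_core_iff_of_boundaryValues (ν i) (hbd i) _).2 ⟨θ, rfl⟩)
  · intro h i hc
    obtain ⟨θ, hθ⟩ := ((g i).mem_core_iff_of_boundaryValues (ν i) (hbd i) _).1 hc
    exact h i ⟨θ, ((closedBallBoundaryData 3).injective_incl hθ).symm⟩

include hbd in
/-- **The parametrisation `S³ ∖ L → D⁴ ∖ ⋃ᵢ h̄ᵢ(S)`, `x ↦ incl x`, exists** (the link version of
`HandleAttachingMap.complementPt`, as an anonymous map `φ` with `(φ x : D⁴) = incl x`).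
[cite: Kirby1989, Ch. I §2] -/
theorem exists_boundaryParam :
    ∃ φ : ↥L.complement → ↥(HandleAttachingMap.coresComplement g),
      ∀ x, (φ x).1 = (closedBallBoundaryData 3).incl x.1 :=
  ⟨fun x => ⟨(closedBallBoundaryData 3).incl x.1, (incl_mem_coresComplement_iff g ν hbd x.1).2 x.2⟩,
    fun _ => rfl⟩

variable {g} (φ : ↥L.complement → ↥(HandleAttachingMap.coresComplement g))
  (hφ : ∀ x, (φ x).1 = (closedBallBoundaryData 3).incl x.1)

include hφ in
/-- The parametrisation `x ↦ incl x` is smooth. [folklore] -/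
theorem contMDiff_boundaryParam : ContMDiff (𝓡 3) (𝓡∂ 4) ∞ φ := by
  rw [← ContMDiff.subtypeVal_comp_iff]
  have : Subtype.val ∘ φ = (closedBallBoundaryData 3).incl ∘ Subtype.val := funext hφ
  rw [this]
  exact (closedBallBoundaryData 3).isSmoothEmbedding.contMDiff.comp contMDiff_subtype_val

include hφ in
/-- The parametrisation `x ↦ incl x` is injective. [folklore] -/
theorem injective_boundaryParam : Injective φ := fun x y h =>
  Subtype.ext ((closedBallBoundaryData 3).injective_incl (by rw [← hφ x, ← hφ y, h]))

include hφ in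
/-- The values of the parametrisation are boundary points. [folklore] -/
theorem boundaryParam_mem_boundary (x : ↥L.complement) :
    φ x ∈ (𝓡∂ 4).boundary ↥(HandleAttachingMap.coresComplement g) := by
  rw [mem_boundary_opens_iff, hφ, ← (closedBallBoundaryData 3).range_incl]
  exact mem_range_self _

include hbd hφ in
/-- **Every boundary point of `D⁴ ∖ ⋃ᵢ h̄ᵢ(S)` comes from `S³ ∖ L`.** [folklore] -/
theorem mem_range_boundaryParam {a : ↥(HandleAttachingMap.coresComplement g)}
    (ha : a ∈ (𝓡∂ 4).boundary ↥(HandleAttachingMap.coresComplement g)) :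
    a ∈ range φ := by
  rw [mem_boundary_opens_iff, ← (closedBallBoundaryData 3).range_incl] at ha
  obtain ⟨x, hx⟩ := ha
  have hx' : x ∈ L.complement := (incl_mem_coresComplement_iff g ν hbd x).1 (hx ▸ a.2)
  exact ⟨⟨x, hx'⟩, Subtype.ext ((hφ _).trans hx)⟩

include hbd hφ in
/-- **Images of open sets are open pieces of the boundary.** [folklore] -/
theorem exists_image_boundaryParam_eq {U : Set ↥L.complement} (hU : IsOpen U) :
    ∃ W : Set ↥(HandleAttachingMap.coresComplement g), IsOpen W ∧
      φ '' U = W ∩ (𝓡∂ 4).boundary ↥(HandleAttachingMap.coresComplement g) := by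
  -- `U = val ⁻¹' U₁` with `U₁` open in `S³`, and `U₁ = incl ⁻¹' W₀` with `W₀` open in `D⁴`
  obtain ⟨U₁, hU₁, rfl⟩ := isOpen_induced_iff.1 hU
  obtain ⟨W₀, hW₀, hW₀U⟩ :=
    (closedBallBoundaryData 3).isSmoothEmbedding.isEmbedding.isInducing.isOpen_iff.1 hU₁
  refine ⟨Subtype.val ⁻¹' W₀, hW₀.preimage continuous_subtype_val, ?_⟩
  ext a
  constructor
  · rintro ⟨x, hx, rfl⟩
    refine ⟨?_, boundaryParam_mem_boundary φ hφ x⟩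
    show (φ x).1 ∈ W₀
    have : x.1 ∈ (closedBallBoundaryData 3).incl ⁻¹' W₀ := by rw [hW₀U]; exact hx
    rw [hφ]
    exact this
  · rintro ⟨haW, hab⟩
    obtain ⟨x, rfl⟩ := mem_range_boundaryParam ν hbd φ hφ hab
    refine ⟨x, ?_, rfl⟩
    show x.1 ∈ U₁
    rw [← hW₀U]
    show (closedBallBoundaryData 3).incl x.1 ∈ W₀
    rw [← hφ]
    exact haW

include hbd hφ in
/-- **A left inverse `D⁴ ∖ ⋃ᵢ h̄ᵢ(S) → S³ ∖ L` of the parametrisation, smooth on the boundary**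
(`incl⁻¹` followed by a choice; the link version of `HandleAttachingMap.complementInv`).
[folklore] -/
theorem exists_leftInverse_boundaryParam (x₀ : ↥L.complement) :
    ∃ ψ : ↥(HandleAttachingMap.coresComplement g) → ↥L.complement, (∀ x, ψ (φ x) = x) ∧
      ContMDiffOn (𝓡∂ 4) (𝓡 3) ∞ ψ ((𝓡∂ 4).boundary ↥(HandleAttachingMap.coresComplement g)) := by
  classical
  set ψ : ↥(HandleAttachingMap.coresComplement g) → ↥L.complement := fun a =>
    if h : (closedBallBoundaryData 3).inclInv a.1 ∈ L.complement then ⟨_, h⟩ else x₀ with hψdef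
  have hψφ : ∀ x, ψ (φ x) = x := fun x => by
    have h1 : (closedBallBoundaryData 3).inclInv (φ x).1 = x.1 := by
      rw [hφ, (closedBallBoundaryData 3).inclInv_incl]
    have h2 : (closedBallBoundaryData 3).inclInv (φ x).1 ∈ L.complement := by rw [h1]; exact x.2
    rw [hψdef]
    dsimp only
    rw [dif_pos h2]
    exact Subtype.ext h1
  refine ⟨ψ, hψφ, fun a ha => ?_⟩
  rw [← ContMDiffWithinAt.subtypeVal_comp_iff]
  have hF : ContMDiffOn (𝓡∂ 4) (𝓡 3) ∞
      (fun a : ↥(HandleAttachingMap.coresComplement g) => (closedBallBoundaryData 3).inclInv a.1)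
      ((𝓡∂ 4).boundary ↥(HandleAttachingMap.coresComplement g)) := by
    refine (closedBallBoundaryData 3).contMDiffOn_inclInv.comp contMDiff_subtype_val.contMDiffOn ?_
    intro a ha
    rw [mem_boundary_opens_iff, ← (closedBallBoundaryData 3).range_incl] at ha
    exact ha
  refine (hF a ha).congr (fun a' ha' => ?_) ?_
  · obtain ⟨x, rfl⟩ := mem_range_boundaryParam ν hbd φ hφ ha'
    rw [comp_apply, hψφ, hφ, (closedBallBoundaryData 3).inclInv_incl]
  · obtain ⟨x, rfl⟩ := mem_range_boundaryParam ν hbd φ hφ ha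
    rw [comp_apply, hψφ, hφ, (closedBallBoundaryData 3).inclInv_incl]

/-! ### §2 The glue relation of the `i`-th handle on the boundary sphere is the `i`-th surgery relation -/

include hbd in
/-- **Kosinski's relation of `h̄ᵢ` on the boundary sphere is the surgery relation of `νᵢ`**:
`h̄ᵢ.glueRel (incl x) (u, (1 - ‖u‖²)^{1/2} w) ↔ Link.surgeryRel ν i x (u, w)` (the one-handle lemma
`HandleAttachingMap.glueRel_incl_beltBoundaryPt_iff` at the component `Lᵢ`).
[cite: Kirby1989, Ch. I §2 Lemma 2.1] -/
theorem glueRel_incl_beltBoundaryPt_iff (i : ι) (x : ↥L.complement) (b : ↥solidTorus) :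
    (g i).glueRel ((closedBallBoundaryData 3).incl x.1) (beltBoundaryPt b).1 ↔ Link.surgeryRel ν i x b := by
  have hx : x.1 ∈ (L.component i).complement :=
    (SphereEmbedding.mem_complement_iff _ _).2 ((Link.mem_complement_iff _ _).1 x.2 i)
  exact (g i).glueRel_incl_beltBoundaryPt_iff (ν i) (hbd i) ⟨x.1, hx⟩ b

/-- **The link complement is nonempty** when the components have pairwise disjoint tubes: a point
of the first tube off its core (or any point of `S³` if there is no component). [folklore] -/
theorem nonempty_complement_of_pairwise_disjoint
    (hνdisj : Pairwise fun i j => Disjoint (range ⇑(ν i)) (range ⇑(ν j))) :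
    Nonempty ↥L.complement := by
  rcases isEmpty_or_nonempty ι with hn | ⟨⟨i₀⟩⟩
  · obtain ⟨p⟩ := nonempty_closedBallBoundaryData_three_carrier
    exact ⟨⟨p, (Link.mem_complement_iff _ _).2 fun i => isEmptyElim i⟩⟩
  · refine ⟨⟨(ν i₀).basePoint.1, (Link.mem_complement_iff _ _).2 fun i hi => ?_⟩⟩
    by_cases h : i = i₀
    · subst h
      exact (SphereEmbedding.mem_complement_iff _ _).1 (ν i).basePoint.2 hi
    · have hmem : ((ν i₀).basePoint.1 : Metric.sphere (0 : EuclideanSpace ℝ (Fin 4)) 1) ∈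
          range ⇑(ν i₀) := by
        rw [Knot.TubularNbhd.coe_basePoint]; exact mem_range_self _
      exact Set.disjoint_left.1 (hνdisj h) ((ν i).range_subset_range hi) hmem

end Link

/-! ### §3 The boundary of the attachment is the surgery on the link -/

/-- **Kirby's Lemma 2.1 for links: the boundary of `D⁴ ∪_L (2-handles)` is the surgery on `L`.**
If `P` is `D⁴` with `2`-handles attached along attaching maps `gᵢ` whose boundary values are pairwise
disjoint oriented tubes `νᵢ` of the components of the framed link `L` with framings `L.framing i`,
then every boundary datum `bP` of `P` has carrier the surgery on `L` (`L.IsSurgery (𝓡 3) bP.carrier`):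
`bP.carrier` is covered by the boundary restrictions of Kosinski's open embeddings — the link
complement `S³ ∖ L` and one open solid torus `D̊² × S¹` per handle — meeting along
`Link.surgeryRel ν i`, the solid tori pairwise disjoint because the handle pieces are.
[cite: Kirby1989, Ch. I §2 Lemma 2.1] [cite: GompfStipsicz1999, §5.3] -/
theorem FramedLink.isSurgery_boundary_of_isMultiAttachment {ι : Type v} [Finite ι] (L : FramedLink ι)
    (g : ι → HandleAttachingMap 3 2 (Metric.closedBall (0 : EuclideanSpace ℝ (Fin 4)) 1))
    (ν : ∀ i, Knot.TubularNbhd ⇑(L.component i))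
    (hfr : ∀ i, (ν i).HasFraming (L.framing i))
    (hνdisj : Pairwise fun i j => Disjoint (range ⇑(ν i)) (range ⇑(ν j)))
    (hbd : ∀ (i : ι) (y : ↥(handleTube 3 2)), tubeDepth y = 0 →
      (g i).toFun y = (closedBallBoundaryData 3).incl (ν i (tubeAngle y, tubeFibre y)))
    {P : Type u} [TopologicalSpace P] [ChartedSpace (EuclideanHalfSpace 4) P] [IsManifold (𝓡∂ 4) ∞ P]
    (hP : HandleAttachingMap.IsMultiAttachment g (𝓡∂ 4) P) (bP : BoundaryData (𝓡∂ 4) P (𝓡 3)) :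
    L.IsSurgery (𝓡 3) bP.carrier := by
  obtain ⟨-, jA, jB, hjA, hjAo, hjB, hcov, hglue, hdisjB⟩ := hP
  obtain ⟨x₀⟩ := Link.nonempty_complement_of_pairwise_disjoint (L := L.toLink) ν hνdisj
  haveI : Nonempty ↥L.toLink.complement := ⟨x₀⟩
  haveI : Nonempty ↥solidTorus := ⟨solidTorusBasePt⟩
  -- the parametrisation of `∂(D⁴ ∖ ⋃ cores)` by the link complement, and its left inverse
  obtain ⟨φ, hφ⟩ := Link.exists_boundaryParam g ν hbd (L := L.toLink)
  obtain ⟨ψ, hψφ, hψ⟩ := Link.exists_leftInverse_boundaryParam ν hbd φ hφ x₀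
  have hφb := Link.boundaryParam_mem_boundary φ hφ
  -- `∂P` is nonempty: it contains the image of a point of `S³ ∖ L`
  haveI : Nonempty bP.carrier := by
    have hb := BoundaryData.apply_mem_boundary hjA hjAo hφb x₀
    rw [← bP.range_incl] at hb
    obtain ⟨z, -⟩ := hb
    exact ⟨z⟩
  -- the restricted embeddings
  set jA₀ := bP.boundaryRestrict jA φ with hjA₀
  set jB₀ : ι → ↥solidTorus → bP.carrier := fun i => bP.boundaryRestrict (jB i) beltBoundaryPt
    with hjB₀
  obtain ⟨hA, hAo⟩ := bP.isSmoothEmbedding_boundaryRestrict hjA hjAo hφb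
    (Link.contMDiff_boundaryParam φ hφ) (Link.injective_boundaryParam φ hφ)
    (fun U hU => Link.exists_image_boundaryParam_eq ν hbd φ hφ hU) hψφ hψ
  have Lin : ((EuclideanSpace ℝ (Fin 2)) × EuclideanSpace ℝ (Fin 1)) ≃L[ℝ] EuclideanSpace ℝ (Fin 3) :=
    ContinuousLinearEquiv.ofFinrankEq (by simp)
  have hB : ∀ i, Manifold.IsSmoothEmbedding (𝓘(ℝ, EuclideanSpace ℝ (Fin 2)).prod (𝓡 1)) (𝓡 3) ∞ (jB₀ i) ∧
      IsOpen (range (jB₀ i)) := fun i =>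
    bP.isSmoothEmbedding_boundaryRestrict_of_boundaryless (hjB i).1 (hjB i).2
      beltBoundaryPt_mem_boundary contMDiff_beltBoundaryPt Lin injective_beltBoundaryPt
      (fun U hU => exists_image_beltBoundaryPt_eq hU) beltBoundaryInv_beltBoundaryPt
      (contMDiffOn_beltBoundaryInv.mono boundary_subset_good)
  refine ⟨ν, hfr, hνdisj, jA₀, jB₀, hA, hAo, hB, ?_, ?_, fun i x b => ?_⟩
  · -- cover: a point of `∂P` is `jA a` or `jB i b` with `a`, `b` boundary points of the pieces
    refine eq_univ_of_forall fun z => ?_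
    have hz : bP.incl z ∈ range jA ∪ ⋃ i, range (jB i) := by rw [hcov]; exact mem_univ _
    rcases hz with ⟨a, ha⟩ | hz
    · exact Or.inl (bP.mem_range_boundaryRestrict hjA hjAo hφb
        (fun a ha => Link.mem_range_boundaryParam ν hbd φ hφ ha) ha.symm)
    · obtain ⟨i, b, hb⟩ := mem_iUnion.1 hz
      exact Or.inr (mem_iUnion.2 ⟨i, bP.mem_range_boundaryRestrict (hjB i).1 (hjB i).2
        beltBoundaryPt_mem_boundary (fun b hb => mem_range_beltBoundaryPt hb) hb.symm⟩)
  · -- the new solid tori are pairwise disjoint, as the handle pieces are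
    intro i j hij
    refine Set.disjoint_left.2 ?_
    rintro z ⟨b, rfl⟩ ⟨b', hb'⟩
    have h1 : bP.incl (jB₀ i b) = jB i (beltBoundaryPt b) :=
      bP.incl_boundaryRestrict (hjB i).1 (hjB i).2 beltBoundaryPt_mem_boundary b
    have h2 : bP.incl (jB₀ j b') = jB j (beltBoundaryPt b') :=
      bP.incl_boundaryRestrict (hjB j).1 (hjB j).2 beltBoundaryPt_mem_boundary b'
    have : jB i (beltBoundaryPt b) ∈ range (jB j) := ⟨beltBoundaryPt b', by rw [← h2, hb', h1]⟩
    exact Set.disjoint_left.1 (hdisjB hij) (mem_range_self _) this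
  · -- the relation
    rw [← Link.glueRel_incl_beltBoundaryPt_iff ν hbd i x b, ← hφ]
    have key : jA₀ x = jB₀ i b ↔ jA (φ x) = jB i (beltBoundaryPt b) := by
      constructor
      · intro h
        have := congrArg bP.incl h
        rwa [hjA₀, hjB₀, bP.incl_boundaryRestrict hjA hjAo hφb,
          bP.incl_boundaryRestrict (hjB i).1 (hjB i).2 beltBoundaryPt_mem_boundary] at this
      · intro h
        apply bP.injective_incl
        rw [hjA₀, hjB₀, bP.incl_boundaryRestrict hjA hjAo hφb,
          bP.incl_boundaryRestrict (hjB i).1 (hjB i).2 beltBoundaryPt_mem_boundary]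
        exact h
    exact key.trans (hglue i _ _)

end Literature.Topology.FourManifolds
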